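import Summits.BirchSwinnertonDyer.BirchSwinnertonDyer.Theorems.SchneiderFreeAdditiveX3AnomalousLambdaLEOfPT
import Summits.BirchSwinnertonDyer.BirchSwinnertonDyer.Theorems.SchneiderFreeAdditiveX3AnomalousTwistAlgebraicSideOfRHPWL
import HarnessLib

/-!
# Route `SchneiderFreeAdditiveX3` (K1 door): the `p = 3` ANOMALOUS column, part 3 — the algebraic side of the anomalous twin down to the primitive
# unramified character duals, on the cell, and with the cotorsion clauses fed from [RH] / [PWL-θ], RE-TYPED GREENBERG-FREE

Cell `bsd-schneider-ideate`, seat `bsd-schneider-door-c5` (prover, generation 40; assembly layer; `--supports` 19177).  PARTITION: board row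
B6 ∩ X3 ∩ sst-twist, `r = 1`, (G-ord, `e = 2`) half at `p = 3`, ANOMALOUS twist (1 725 of 2 411 pairs; class-wide) of `Rank1Residual.partition` —
ASSEMBLY; types-the-object-of nothing new; RE-KEYS generations 31–32's `AnomalousTwistAlgebraicSide` §§1–2 and `AnomalousTwistAlgebraicSideOfRHPWL` §1 off
Greenberg's papers, on F40a/F40b; closes none of B6's cells (BSD NOT advanced).  bears_on: K1-door (19177 r3).  Proofs token-identical to generations
31–32 with the binder block `(h263 h41 h42 h5A h32)` replaced by `hPT` = Milne ADT I Thm. 4.10 (a) at finite `S` over totally complex fields and the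
Greenberg-free callees of F40a/F40b called (Greenberg 2016 Prop. 2.6.3 (c) at totally complex `K` from `hPT` by cell `bsd-eis`'s road «SUR-Λ»; Greenberg
2006 and Tate's Euler characteristic at totally complex fields by tree theorems).
HONEST FRAMING: compositions of tree theorems, CONDITIONAL BY NAME on the displayed statements ([RH], [PWL-θ] = Keller–Yin 2402.12781 Thm. 1.2.2 /
Prop. 1.2.5, refereed-journal status per the cell's memos; CGLS; Milne); no definition, no named fact, no `sorry`; nothing analytic; nothing is closed;
BSD proved for no curve; «closes rung: none».  References: [KellerYin2024] Thms. 1.2.2, 1.4.1, Prop. 1.2.5, §1.4; [CastellaGrossiLeeSkinner2022] Prop.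
1.2.5; [MilneADT2006] I Thm. 4.10 (a); [Greenberg2016Selmer] Prop. 2.6.3 (c); this seat (gens 31–32); F40a, F40b.
-/

set_option autoImplicit false
set_option linter.dupNamespace false -- the route's Theorems namespace repeats the summit name by design (D-0017 nested layout)

noncomputable section

open scoped Classical
open NumberField IsDedekindDomain Field Multiplicative PowerSeries WeierstrassCurve
open Literature.NumberTheory.EllipticCurves Literature.NumberTheory.EllipticCurves.GreenbergSelmer
  Literature.NumberTheory.EllipticCurves.GreenbergVatsal2000 Literature.NumberTheory.GaloisRepresentations
  Literature.NumberTheory.EllipticCurves.KellerYin2024 Literature.NumberTheory.EllipticCurves.IwasawaDual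
  Literature.NumberTheory.IwasawaTheory Literature.NumberTheory.IwasawaTheory.Greenberg2016
  Literature.NumberTheory.IwasawaTheory.Greenberg2006 Literature.NumberTheory.EllipticCurves.Castella2018
  Literature.NumberTheory.GaloisCohomology
  Literature.NumberTheory.EllipticCurves.Rank1Residual
  Summit.BirchSwinnertonDyer.Rank1Residual Summit.BirchSwinnertonDyer.Rank1Residual.Additive
  Summit.BirchSwinnertonDyer.Rank1Residual.GaloisImage
  Summit.BirchSwinnertonDyer.BirchSwinnertonDyer.Theorems
  Summit.BirchSwinnertonDyer.BirchSwinnertonDyer.Theorems.ResidualLineRigidity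
  Summit.BirchSwinnertonDyer.BirchSwinnertonDyer.Theorems.EisensteinPrimesMuLambda
  Summit.BirchSwinnertonDyer.BirchSwinnertonDyer.Theorems.SchneiderFreeAdditiveX3
  Summit.BirchSwinnertonDyer.BirchSwinnertonDyer.Theorems.SchneiderFreeAdditiveX3.AnomalousTwistPartnerFacts
open Literature.NumberTheory.EllipticCurves.KellerYin2024 (thm122_rubinHida_residualPair_unrSelmer prop125_residualPair_unrSelmer_imprimitive)

namespace Summit.BirchSwinnertonDyer.BirchSwinnertonDyer.Theorems.SchneiderFreeAdditiveX3.AnomalousTwistAlgebraicSideOfPT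

variable {K : Type} [Field K] [NumberField K] {p : ℕ} [hp : Fact p.Prime]

/-! ### §1 The algebraic side of the anomalous twin, Greenberg-free -/

/-- **THE ALGEBRAIC SIDE of the anomalous twin down to the PRIMITIVE unramified character duals, Greenberg-free:** `λ(𝔛_{θsub}) + λ(𝔛_{θquot}) +
Σ_{w∈Sf}(λ𝒫_w(θsub) + λ𝒫_w(θquot)) ≤ λ(X_ac^∅(W_K)) + Σ_{w∈Sf} λ𝒫_w(W_K)` for the anomalous `(−3)`-twist `W = C • V^{(−3)}` — generation 31's
`AnomalousTwistAlgebraicSide.lambdaInvariant_primitive_add_sum_le_of_anomalousTwist` on F40a (bad-place clauses) and F40b (the anomalous λ-inequality off `p`);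
inputs displayed: Milne ADT I Thm. 4.10 (a) (`hPT`), `cd_3 ≤ 2` (`hCD2`), the cotorsion clauses. [cite: KellerYin2024, Thm. 1.4.1 (iii), Prop. 1.2.5, §1.4 (arXiv:2402.12781v2)]
[cite: CastellaGrossiLeeSkinner2022, Prop. 1.2.5] [cite: MilneADT2006, I Thm. 4.10 (a)] -/
theorem lambdaInvariant_primitive_add_sum_le_of_anomalousTwist {V : WeierstrassCurve ℚ} [V.IsElliptic] [V.IsGloballyMinimal]
    (hPT : ∀ (L : Type) [Field L] [NumberField L] [IsTotallyComplex L] (S : Set (HeightOneSpectrum (𝓞 L))),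
      S.Finite → Literature.NumberTheory.GaloisCohomology.poitouTate_shaRestricted_tateDual_natural_at L S)
    (W : WeierstrassCurve ℚ) [W.IsElliptic] [W.IsGloballyMinimal]
    (hp3 : p = 3) (hV : GoodOrd V p) (ha : (p : ℤ) ∣ V.frobeniusTrace p - 1)
    (C : VariableChange ℚ) (hC : C • V.quadraticTwist ((-1 : ℚ) ^ (p / 2) * p) = W) (haddv : Addv W p)
    (hK : IsImaginaryQuadratic K) (hCD2 : groupCdLE_two_galoisGroupUnramifiedOutside K)
    (hH : SatisfiesHeegnerHypothesis (W.conductorNorm ℤ) K)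
    (htor : ∀ Q : (W.baseChange K).toAffine.Point, p • Q = 0 → Q = 0)
    (ι : K →+* ℚ_[p]) (v vbar : HeightOneSpectrum (𝓞 K))
    (hv : ∀ x : 𝓞 K, x ∈ v.asIdeal ↔ ‖ι (x : K)‖ < 1)
    (hvbar : ((p : ℕ) : 𝓞 K) ∈ vbar.asIdeal) (hne : vbar ≠ v)
    (κ : ZpExtension K p) (hκ : κ.IsAnticyclotomic)
    (γ : absoluteGaloisGroup K) [Fact (κ.IsTopGenerator γ)]
    (θsub θquot : FramedGaloisRep K (padicCoeffIntegers (∅ : Set (PadicAlgCl p))) 1)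
    (hpair : IsResidualPairOver (W.baseChange K) p θsub θquot)
    (hram : ∃ τ ∈ decomp vbar, unitChar θsub τ ≠ 1)
    (hfinED : Finite {x : ↥((W.baseChange K).geomPrimaryTorsion p) // ∀ g : ↥(κ.kerSubgroup ⊓ decomp vbar), g • x = x})
    (Sf : Finset (HeightOneSpectrum (𝓞 K)))
    (hSf : ∀ w : HeightOneSpectrum (𝓞 K), w ∈ Sf ↔
      (((W.conductorNorm ℤ : ℤ) : 𝓞 K) ∈ w.asIdeal ∧ ((p : ℕ) : 𝓞 K) ∉ w.asIdeal))
    (Dsub : DatumDualData κ γ (charModule ∅ θsub)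
        (AcSelmer.bdpData (charModule ∅ θsub) p vbar) (∅ : Set (HeightOneSpectrum (𝓞 K))))
    (Dquot : DatumDualData κ γ (charModule ∅ θquot)
        (AcSelmer.bdpData (charModule ∅ θquot) p vbar) (∅ : Set (HeightOneSpectrum (𝓞 K))))
    (hfgS : Module.Finite (IwasawaAlgebra p) (AcSelmer.XAc (W.baseChange K) p κ vbar (↑Sf : Set (HeightOneSpectrum (𝓞 K))) γ))
    (htorS : Module.IsTorsion (IwasawaAlgebra p) (AcSelmer.XAc (W.baseChange K) p κ vbar (↑Sf : Set (HeightOneSpectrum (𝓞 K))) γ))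
    (hμS : muInvariant p (AcSelmer.XAc (W.baseChange K) p κ vbar (↑Sf : Set (HeightOneSpectrum (𝓞 K))) γ) = 0)
    (hRHsub : ∀ D : DatumDualData κ γ (charModule ∅ θsub)
        (AcSelmer.bdpData (charModule ∅ θsub) p vbar) (∅ : Set (HeightOneSpectrum (𝓞 K))),
      Module.Finite (IwasawaAlgebra p) D.X ∧ Module.IsTorsion (IwasawaAlgebra p) D.X ∧ muInvariant p D.X = 0)
    (hRHquot : ∀ D : DatumDualData κ γ (charModule ∅ θquot)
        (AcSelmer.bdpData (charModule ∅ θquot) p vbar) (∅ : Set (HeightOneSpectrum (𝓞 K))),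
      Module.Finite (IwasawaAlgebra p) D.X ∧ Module.IsTorsion (IwasawaAlgebra p) D.X ∧ muInvariant p D.X = 0) :
    lambdaInvariant p Dsub.X + lambdaInvariant p Dquot.X +
        ∑ w ∈ Sf, (charLocalLambda ∅ κ θsub w + charLocalLambda ∅ κ θquot w) ≤
      lambdaInvariant p (AcSelmer.XAc (W.baseChange K) p κ vbar (↑Sf : Set (HeightOneSpectrum (𝓞 K))) γ) +
        (if ∀ σ : absoluteGaloisGroup K, θquot σ = 1 then 1 else 0) := by
  have hγ : κ.IsTopGenerator γ := Fact.out
  have hp : 2 < p := by omega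
  -- imprimitive dual data over `Sf` exist
  obtain ⟨DSsub⟩ := nonempty_unrDualData_char (∅ : Set (PadicAlgCl p)) θsub κ vbar (↑Sf : Set (HeightOneSpectrum (𝓞 K))) hγ
  obtain ⟨DSquot⟩ := nonempty_unrDualData_char (∅ : Set (PadicAlgCl p)) θquot κ vbar (↑Sf : Set (HeightOneSpectrum (𝓞 K))) hγ
  -- Prop. 1.2.5 at the bad prime for both characters: cotorsion of every imprimitive datum and the `λ`-shifts
  have hsubP := fun DS ↦ BadPrimeCharImprimitiveShiftOfPT.imprimitive_clauses_of_not_good hPT W hp haddv.1 hK hH hv hvbar hne κ hκ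
    γ hpair Sf hSf θsub (Or.inl rfl) hRHsub Dsub DS
  have hquotP := fun DS ↦ BadPrimeCharImprimitiveShiftOfPT.imprimitive_clauses_of_not_good hPT W hp haddv.1 hK hH hv hvbar hne κ
    hκ γ hpair Sf hSf θquot (Or.inr rfl) hRHquot Dquot DS
  have hSsub : ∀ DS : DatumDualData κ γ (charModule ∅ θsub)
      (AcSelmer.bdpData (charModule ∅ θsub) p vbar) (↑Sf : Set (HeightOneSpectrum (𝓞 K))),
      Module.Finite (IwasawaAlgebra p) DS.X ∧ Module.IsTorsion (IwasawaAlgebra p) DS.X ∧ muInvariant p DS.X = 0 := fun DS ↦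
    ⟨(hsubP DS).1, (hsubP DS).2.1, (hsubP DS).2.2.1⟩
  have hSquot : ∀ DS : DatumDualData κ γ (charModule ∅ θquot)
      (AcSelmer.bdpData (charModule ∅ θquot) p vbar) (↑Sf : Set (HeightOneSpectrum (𝓞 K))),
      Module.Finite (IwasawaAlgebra p) DS.X ∧ Module.IsTorsion (IwasawaAlgebra p) DS.X ∧ muInvariant p DS.X = 0 := fun DS ↦
    ⟨(hquotP DS).1, (hquotP DS).2.1, (hquotP DS).2.2.1⟩
  have hlsub : lambdaInvariant p DSsub.X = lambdaInvariant p Dsub.X + ∑ w ∈ Sf, charLocalLambda ∅ κ θsub w := (hsubP DSsub).2.2.2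
  have hlquot : lambdaInvariant p DSquot.X = lambdaInvariant p Dquot.X + ∑ w ∈ Sf, charLocalLambda ∅ κ θquot w := (hquotP DSquot).2.2.2
  -- KY Thm. 1.4.1 (iii) for the anomalous twist, imprimitive duals (FILE 7)
  have hmain := AnomalousTwistLambdaLEOfPT.lambdaInvariant_add_le_of_anomalousTwist_offP hPT W p hp3 hV ha C hC haddv K hK
    hCD2 hH htor ι v vbar hv hvbar hne κ hκ γ θsub θquot hpair hram hfinED Sf hSf DSsub DSquot hfgS htorS hμS hSsub hSquot
  rw [hlsub, hlquot] at hmain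
  rw [Finset.sum_add_distrib]
  omega

/-- **The same on the door's cell at `p = 3` for a NORMALISED anomalous twist model** (`ClassX3 W 3`, `SubGordTwo W 3`, `r_an = 1`; Fin_v from the closed crux r5
`localTowerTorsionFiniteX3_proof`, `cd_3(G_{K,Σ}) ≤ 2` from the tree) — generation 31's `…_of_normalised`, Greenberg-free.
[cite: KellerYin2024, Thm. 1.4.1 (iii) (arXiv:2402.12781v2)] [cite: MilneADT2006, I Thm. 4.10 (a)] -/
theorem lambdaInvariant_primitive_add_sum_le_three_of_anomalousTwist_of_normalised
    (hPT : ∀ (L : Type) [Field L] [NumberField L] [IsTotallyComplex L] (S : Set (HeightOneSpectrum (𝓞 L))),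
      S.Finite → Literature.NumberTheory.GaloisCohomology.poitouTate_shaRestricted_tateDual_natural_at L S)
    (W : WeierstrassCurve ℚ) [W.IsElliptic] [W.IsGloballyMinimal]
    (hr : W.analyticRank = 1) (hX : ClassX3 W 3) (hSG : SubGordTwo W 3)
    {V : WeierstrassCurve ℚ} [V.IsElliptic] [V.IsGloballyMinimal] (hV : GoodOrd V 3) (ha : (3 : ℤ) ∣ V.frobeniusTrace 3 - 1)
    (C : VariableChange ℚ) (hC : C • V.quadraticTwist ((-1 : ℚ) ^ ((3 : ℕ) / 2) * ((3 : ℕ) : ℚ)) = W)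
    (hnorm : ∀ Ψ : AddSubgroup (geomTorsion W ((3 : ℕ) : ℤ)), IsRationalLine W 3 Ψ → ¬ LineDecompositionTrivialAt W 3 Ψ)
    (hK : IsImaginaryQuadratic K) (hCD2 : groupCdLE_two_galoisGroupUnramifiedOutside K)
    (hH : SatisfiesHeegnerHypothesis (W.conductorNorm ℤ) K)
    (ι : K →+* ℚ_[3]) (v vbar : HeightOneSpectrum (𝓞 K))
    (hv : ∀ x : 𝓞 K, x ∈ v.asIdeal ↔ ‖ι (x : K)‖ < 1)
    (hvbar : ((3 : ℕ) : 𝓞 K) ∈ vbar.asIdeal) (hne : vbar ≠ v)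
    (κ : ZpExtension K 3) (hκ : κ.IsAnticyclotomic)
    (γ : absoluteGaloisGroup K) [Fact (κ.IsTopGenerator γ)]
    (θsub θquot : FramedGaloisRep K (padicCoeffIntegers (∅ : Set (PadicAlgCl 3))) 1)
    (hpair : IsResidualPairOver (W.baseChange K) 3 θsub θquot)
    (Sf : Finset (HeightOneSpectrum (𝓞 K)))
    (hSf : ∀ w : HeightOneSpectrum (𝓞 K), w ∈ Sf ↔
      (((W.conductorNorm ℤ : ℤ) : 𝓞 K) ∈ w.asIdeal ∧ ((3 : ℕ) : 𝓞 K) ∉ w.asIdeal))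
    (Dsub : DatumDualData κ γ (charModule ∅ θsub)
        (AcSelmer.bdpData (charModule ∅ θsub) 3 vbar) (∅ : Set (HeightOneSpectrum (𝓞 K))))
    (Dquot : DatumDualData κ γ (charModule ∅ θquot)
        (AcSelmer.bdpData (charModule ∅ θquot) 3 vbar) (∅ : Set (HeightOneSpectrum (𝓞 K))))
    (hfgS : Module.Finite (IwasawaAlgebra 3) (AcSelmer.XAc (W.baseChange K) 3 κ vbar (↑Sf : Set (HeightOneSpectrum (𝓞 K))) γ))
    (htorS : Module.IsTorsion (IwasawaAlgebra 3) (AcSelmer.XAc (W.baseChange K) 3 κ vbar (↑Sf : Set (HeightOneSpectrum (𝓞 K))) γ))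
    (hμS : muInvariant 3 (AcSelmer.XAc (W.baseChange K) 3 κ vbar (↑Sf : Set (HeightOneSpectrum (𝓞 K))) γ) = 0)
    (hRHsub : ∀ D : DatumDualData κ γ (charModule ∅ θsub)
        (AcSelmer.bdpData (charModule ∅ θsub) 3 vbar) (∅ : Set (HeightOneSpectrum (𝓞 K))),
      Module.Finite (IwasawaAlgebra 3) D.X ∧ Module.IsTorsion (IwasawaAlgebra 3) D.X ∧ muInvariant 3 D.X = 0)
    (hRHquot : ∀ D : DatumDualData κ γ (charModule ∅ θquot)
        (AcSelmer.bdpData (charModule ∅ θquot) 3 vbar) (∅ : Set (HeightOneSpectrum (𝓞 K))),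
      Module.Finite (IwasawaAlgebra 3) D.X ∧ Module.IsTorsion (IwasawaAlgebra 3) D.X ∧ muInvariant 3 D.X = 0) :
    lambdaInvariant 3 Dsub.X + lambdaInvariant 3 Dquot.X +
        ∑ w ∈ Sf, (charLocalLambda ∅ κ θsub w + charLocalLambda ∅ κ θquot w) ≤
      lambdaInvariant 3 (AcSelmer.XAc (W.baseChange K) 3 κ vbar (↑Sf : Set (HeightOneSpectrum (𝓞 K))) γ) +
        (if ∀ σ : absoluteGaloisGroup K, θquot σ = 1 then 1 else 0) := by
  have h32' : (3 : ℕ) ≠ 2 := by decide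
  have hpvK : ((3 : ℕ) : 𝓞 K) ∈ v.asIdeal := IndexPlumbingNrVsStrict.natCast_mem_asIdeal_of_forall_norm_iff hv
  have haddv : Addv W 3 := hX.2
  have hpN : 3 ∣ W.conductorNorm ℤ := (W.dvd_conductorNorm_iff_not_hasGoodReductionAtPrime 3).mpr haddv.1
  have hsplit : X11b.SplitsIn K 3 := splitsIn_of_satisfiesHeegnerHypothesis rfl hH hpN
  have hram : ∃ τ ∈ decomp vbar, unitChar θsub τ ≠ 1 :=
    AnomalousTwistOrientation.exists_mem_decomp_unitChar_ne_one_of_anomalousTwist_of_normalised rfl hV ha C hC hnorm hX.1 hK hpvK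
      hvbar hne hpair
  have htor : ∀ Q : (W.baseChange K).toAffine.Point, 3 • Q = 0 → Q = 0 :=
    AnomalousTwistOrientation.forall_baseChange_nsmul_eq_zero_of_anomalousTwist_of_normalised rfl hV ha C hC hnorm hX.1 hK hpvK hvbar hne
  have hfinED : Finite {x : ↥((W.baseChange K).geomPrimaryTorsion 3) // ∀ g : ↥(κ.kerSubgroup ⊓ decomp vbar), g • x = x} := by
    have hfin := localTowerTorsionFiniteX3_proof W 3 hr h32' hX (Or.inr hSG) K hK hsplit κ hκ vbar hvbar
    haveI := hfin.to_subtype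
    refine Finite.of_injective (fun x ↦ (⟨x.1, (FixedPoints.mem_addSubgroup _ _ _).mpr fun g ↦
      x.2 ⟨g.1, Subgroup.mem_inf.mpr (Subgroup.mem_inf.mp g.2).symm⟩⟩ :
        ↥(FixedPoints.addSubgroup ↥(decomp vbar ⊓ κ.kerSubgroup) ((W.baseChange K).geomPrimaryTorsion 3)))) fun a b hab ↦ ?_
    have h := congrArg Subtype.val hab
    exact Subtype.ext h
  exact lambdaInvariant_primitive_add_sum_le_of_anomalousTwist hPT W rfl hV ha C hC haddv hK hCD2 hH htor ι v vbar hv hvbar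
    hne κ hκ γ θsub θquot hpair hram hfinED Sf hSf Dsub Dquot hfgS htorS hμS hRHsub hRHquot


/-! ### §2 The cotorsion clauses fed from [RH] / [PWL-θ], restricted pair -/

/-- **THE ALGEBRAIC SIDE OF THE ANOMALOUS TWIN ON THE (G-ord, `e = 2`) CELL AT `p = 3`, RESTRICTED PAIR, ⟸ [RH] + [PWL-θ] + CGLS Prop. 1.2.5 + Milne I 4.10 (a) BY NAME,
Greenberg-free** — generation 32's `AnomalousTwistAlgebraicSideOfRHPWL.…_restrict` (cotorsion clauses from Keller–Yin 2402.12781 Thm 1.2.2 [RH] and Prop 1.2.5 [PWL-θ]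
at the partner's data) on the theorem above. [cite: KellerYin2024, Thms. 1.2.2, 1.4.1, Prop. 1.2.5 (arXiv:2402.12781v2)] [cite: MilneADT2006, I Thm. 4.10 (a)] -/
theorem lambdaInvariant_primitive_add_sum_le_three_of_RH_of_PWL_of_normalised_restrict
    (hPT : ∀ (L : Type) [Field L] [NumberField L] [IsTotallyComplex L] (S : Set (HeightOneSpectrum (𝓞 L))),
      S.Finite → Literature.NumberTheory.GaloisCohomology.poitouTate_shaRestricted_tateDual_natural_at L S)
    (hRH : thm122_rubinHida_residualPair_unrSelmer) (hPWL : prop125_residualPair_unrSelmer_imprimitive)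
    (W : WeierstrassCurve ℚ) [W.IsElliptic] [W.IsGloballyMinimal]
    (hr : W.analyticRank = 1) (hX : ClassX3 W 3) (hSG : SubGordTwo W 3)
    {V : WeierstrassCurve ℚ} [V.IsElliptic] [V.IsGloballyMinimal] (hV : GoodOrd V 3) (ha : (3 : ℤ) ∣ V.frobeniusTrace 3 - 1)
    (C : VariableChange ℚ) (hC : C • V.quadraticTwist ((-1 : ℚ) ^ ((3 : ℕ) / 2) * ((3 : ℕ) : ℚ)) = W)
    (hnorm : ∀ Φ : AddSubgroup (geomTorsion W ((3 : ℕ) : ℤ)), IsRationalLine W 3 Φ → ¬ LineDecompositionTrivialAt W 3 Φ)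
    (hK : IsImaginaryQuadratic K) (hCD2 : groupCdLE_two_galoisGroupUnramifiedOutside K)
    (hH : SatisfiesHeegnerHypothesis (W.conductorNorm ℤ) K)
    (ι : K →+* ℚ_[3]) (v vbar : HeightOneSpectrum (𝓞 K))
    (hv : ∀ x : 𝓞 K, x ∈ v.asIdeal ↔ ‖ι (x : K)‖ < 1)
    (hvbar : ((3 : ℕ) : 𝓞 K) ∈ vbar.asIdeal) (hne : vbar ≠ v)
    (κ : ZpExtension K 3) (hκ : κ.IsAnticyclotomic)
    (γ : absoluteGaloisGroup K) [Fact (κ.IsTopGenerator γ)]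
    {Ψ : AddSubgroup (geomTorsion W ((3 : ℕ) : ℤ))} (hΨ : IsRationalLine W 3 Ψ)
    {θsub θquot : FramedGaloisRep ℚ (padicCoeffIntegers (∅ : Set (PadicAlgCl 3))) 1}
    (hsub : IsTeichmullerLiftOn (∅ : Set (PadicAlgCl 3)) (Ψ.map (geomTorsion W ((3 : ℕ) : ℤ)).subtype) θsub)
    (hquot : IsTeichmullerLiftOnQuot (∅ : Set (PadicAlgCl 3)) (Ψ.map (geomTorsion W ((3 : ℕ) : ℤ)).subtype)
      (geomTorsion W ((3 : ℕ) : ℤ)) θquot)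
    (Sf : Finset (HeightOneSpectrum (𝓞 K)))
    (hSf : ∀ w : HeightOneSpectrum (𝓞 K), w ∈ Sf ↔
      (((W.conductorNorm ℤ : ℤ) : 𝓞 K) ∈ w.asIdeal ∧ ((3 : ℕ) : 𝓞 K) ∉ w.asIdeal))
    (Dsub : DatumDualData κ γ (charModule ∅ (θsub.restrictField K))
        (AcSelmer.bdpData (charModule ∅ (θsub.restrictField K)) 3 vbar) (∅ : Set (HeightOneSpectrum (𝓞 K))))
    (Dquot : DatumDualData κ γ (charModule ∅ (θquot.restrictField K))
        (AcSelmer.bdpData (charModule ∅ (θquot.restrictField K)) 3 vbar) (∅ : Set (HeightOneSpectrum (𝓞 K)))) :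
    lambdaInvariant 3 Dsub.X + lambdaInvariant 3 Dquot.X +
        ∑ w ∈ Sf, (charLocalLambda ∅ κ (θsub.restrictField K) w + charLocalLambda ∅ κ (θquot.restrictField K) w) ≤
      lambdaInvariant 3 (AcSelmer.XAc (W.baseChange K) 3 κ vbar (↑Sf : Set (HeightOneSpectrum (𝓞 K))) γ) +
        (if ∀ σ : absoluteGaloisGroup K, θquot.restrictField K σ = 1 then 1 else 0) := by
  have h3 : ((-1 : ℚ) ^ ((3 : ℕ) / 2) * ((3 : ℕ) : ℚ)) = (-3 : ℚ) := by norm_num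
  have hC' : C • V.quadraticTwist (-3 : ℚ) = W := by rw [← h3]; exact hC
  have hsplit : ((Ideal.span {(3 : ℤ)}).primesOver (𝓞 K)).ncard = 2 := by
    exact_mod_cast hH 3 Nat.prime_three ((W.dvd_conductorNorm_iff_not_hasGoodReductionAtPrime 3).mpr hX.2.1)
  have hpair : IsResidualPairOver (W.baseChange K) 3 (θsub.restrictField K) (θquot.restrictField K) :=
    isResidualPairOver_restrictField W 3 K hΨ hsub hquot
  -- [RH] ×2 and [INV.μ] by name (FILE 12a)
  obtain ⟨hRHsub, hRHquot⟩ := charDuals_moduleFinite_isTorsion_muInvariant_of_RH_of_anomalousTwist hRH C hC' hV ha K hK hH hsplit ι v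
    vbar hv hvbar hne κ hκ γ hΨ hsub hquot
  obtain ⟨⟨hfgS, htorS, hμS⟩, -⟩ := xAc_moduleFinite_isTorsion_muInvariant_of_RH_of_PWL_of_anomalousTwist hRH hPWL C hC' hV ha hX.1 K hK hH
    hsplit ι v vbar hv hvbar hne κ hκ γ Sf hSf
  exact AnomalousTwistAlgebraicSideOfPT.lambdaInvariant_primitive_add_sum_le_three_of_anomalousTwist_of_normalised hPT W hr hX
    hSG hV ha C hC hnorm hK hCD2 hH ι v vbar hv hvbar hne κ hκ γ (θsub.restrictField K) (θquot.restrictField K) hpair Sf hSf Dsub Dquot hfgS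
    htorS hμS hRHsub hRHquot

end Summit.BirchSwinnertonDyer.BirchSwinnertonDyer.Theorems.SchneiderFreeAdditiveX3.AnomalousTwistAlgebraicSideOfPT

end
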